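import Summits.CriticalPhenomena.PercolationContinuityZ3.Theorems.SahiMasterFamilyStrictHarris

/-!
# Heredity of zeros, the peeled step, and the identically-zero form of the master equality conjecture

Companion of `SahiMasterFamily.lean` / `SahiMasterFamilyStrictHarris.lean` (crux `NoHeavyLowerTail`,
stmt-CriticalPhenomena-4575; cell `prim-l12`, unit `prim-master-conj`).  Sahi's functionals `E_k`
[Sahi2008; LiebSahi2021, Def. 3.1] of `k` increasing events `U_j` under a product measure `μ_p`, the zero-flag
class `Z_k = SuppZeroFlag k` and the statements `MasterFamilyNonneg k` / `MasterFamilyEqIff k` are those of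
`SahiMasterFamily.lean`.  This file PROVES:

* **the peeled step** (`sahiE_ind_step`): if the sub-family `U_{−m}` (slot `m` deleted) lies in `Z_{k+2}` then
  `E_{k+3}(U) = Σ_l E_{k+2}(U_{−m} with U_l ↦ U_l ∩ U_m)` (Lieb–Sahi recursion peeled at `m`, `sahiE_peel`); hence,
  GIVEN `MasterFamilyNonneg (k+2)` and `MasterFamilyEqIff (k+2)`, `E_{k+3}(U) ≥ 0` and `E_{k+3}(U) = 0 ↔ U ∈ Z_{k+3}`
  (`masterFamily_step`).  At `k + 2 = 2` both inputs are theorems (Harris, strict Harris), so UNCONDITIONALLY: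
  **for three increasing events two of which are determined by disjoint coordinate sets, `E_3 ≥ 0` for every
  `p ∈ [0,1]^ι` (Kahn's Conjecture 5 holds on such triples) and, for `p` in the open cube, `E_3 = 0 ↔ (Z)`**
  (`sahiE_three_ind_nonneg_of_indepPair`, `sahiE_three_ind_eq_zero_iff_of_indepPair`);
* **heredity ⟺ equality**: with `MasterFamilyHeredity (k+3)` := "`E_{k+3}(U) = 0 ⇒ E_{k+2}(U_{−m}) = 0` for some
  `m`", `MasterFamilyNonneg (k+2) → MasterFamilyEqIff (k+2) → (MasterFamilyEqIff (k+3) ↔ MasterFamilyHeredity (k+3))`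
  (`masterFamilyEqIff_iff_heredity`); unconditionally `MasterFamilyEqIff 3 ↔ MasterFamilyHeredity 3`;
* **the identically-zero form** `MasterFamilyIdentEqIff k` ("`E_k(μ_p; 1_U) = 0` for EVERY interior `p` `↔ Z_k`"),
  implied by the pointwise form, true for `k ≤ 2`, and for `k = 3` EQUIVALENT to the purely combinatorial
  statement `SahiE3NonvanishingOfPairwiseDependent` ("three increasing events, every two of which share an
  essential coordinate, have `E_3(μ_p) ≠ 0` for SOME interior `p`") (`masterFamilyIdentEqIff_three_iff`).
  Unlike the pointwise form (which implies Kahn's conjecture, `SahiMasterFamilyEqImpliesNonneg.lean`), this form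
  does not contain `C_3`; it is the cell's honest proof target for (EQ-3).
No conjecture is asserted; `MasterFamilyHeredity`, `MasterFamilyIdentEqIff`, `SahiE3NonvanishingOfPairwiseDependent`
are `@[conjecture]` statements (open for `k ≥ 3`; census-exact on `{0,1}^m`, `m ≤ 5`, MASTER-FAMILY.md §MASTER). [this work]
-/

noncomputable section

open scoped Classical

namespace Summit.CriticalPhenomena.PercolationContinuityZ3.Theorems

open Finset Function MeasureTheory
open Literature.Combinatorics.Sahi2008
open Literature.Probability.Percolation (DeterminedBy)
open Literature.Probability.Percolation.DecisionTree (ind ind_of_mem ind_of_not_mem ind_nonneg)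

section Step

variable {ι : Type*} [Fintype ι]

omit [Fintype ι] in
/-- The modified families `U_{−m}` with `U_l ↦ U_l ∩ U_m` consist of increasing events. [folklore] -/
theorem isUpperSet_update_inter {k : ℕ} {U : Fin (k + 3) → Set (Set ι)} (hU : ∀ j, IsUpperSet (U j))
    (m : Fin (k + 3)) (l : Fin (k + 2)) (j : Fin (k + 2)) :
    IsUpperSet (update (fun j => U (m.succAbove j)) l (U (m.succAbove l) ∩ U m) j) := by
  by_cases hj : j = l
  · subst hj; rw [update_self]; exact (hU _).inter (hU m)
  · rw [update_of_ne hj]; exact hU _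

/-- **The peeled step.** If `U_{−m} ∈ Z_{k+2}` then
`E_{k+3}(μ_p; 1_U) = Σ_l E_{k+2}(μ_p; 1_{U_{−m} with U_l ↦ U_l ∩ U_m})` (every `p ∈ [0,1]^ι`): the Lieb–Sahi
recursion peeled at slot `m` (`sahiE_peel`), its last term killed by `Z_{k+2} ⇒ E_{k+2} = 0`. [this work] -/
theorem sahiE_ind_step (p : ι → unitInterval) {k : ℕ} (U : Fin (k + 3) → Set (Set ι)) (m : Fin (k + 3))
    (hZ : SuppZeroFlag (k + 2) (fun j => U (m.succAbove j))) :
    sahiE (bernoulliWeight p) (k + 3) (fun j => ind (U j)) =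
      ∑ l : Fin (k + 2), sahiE (bernoulliWeight p) (k + 2)
        (fun j => ind (update (fun j => U (m.succAbove j)) l (U (m.succAbove l) ∩ U m) j)) := by
  rw [sahiE_peel (bernoulliWeight p) (k + 1) (fun j => ind (U j)) m]
  have h0 : sahiE (bernoulliWeight p) (k + 2) (fun j => ind (U (m.succAbove j))) = 0 :=
    sahiE_ind_eq_zero_of_suppZeroFlag p hZ
  rw [h0, zero_mul, sub_zero]
  refine sum_congr rfl fun l _ => ?_
  rw [ind_update_inter]

/-- **The step of the master conjecture** (order `k + 2 ⇒ k + 3` on families with a zero-flag sub-family): given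
`MasterFamilyNonneg (k+2)` and `MasterFamilyEqIff (k+2)`, if `U_{−m} ∈ Z_{k+2}` then `E_{k+3}(μ_p; 1_U) ≥ 0` and,
for `p` in the open cube, `E_{k+3}(μ_p; 1_U) = 0 ↔ U ∈ Z_{k+3}`. [this work] -/
theorem masterFamily_step {k : ℕ} (hN : MasterFamilyNonneg (k + 2)) (hE : MasterFamilyEqIff (k + 2))
    {ι : Type} [Fintype ι] (p : ι → unitInterval) (hp : ∀ e, (p e : ℝ) ∈ Set.Ioo (0 : ℝ) 1)
    (U : Fin (k + 3) → Set (Set ι)) (hU : ∀ j, IsUpperSet (U j)) (m : Fin (k + 3))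
    (hZ : SuppZeroFlag (k + 2) (fun j => U (m.succAbove j))) :
    0 ≤ sahiE (bernoulliWeight p) (k + 3) (fun j => ind (U j)) ∧
      (sahiE (bernoulliWeight p) (k + 3) (fun j => ind (U j)) = 0 ↔ SuppZeroFlag (k + 3) U) := by
  have hterm : ∀ l : Fin (k + 2), 0 ≤ sahiE (bernoulliWeight p) (k + 2)
      (fun j => ind (update (fun j => U (m.succAbove j)) l (U (m.succAbove l) ∩ U m) j)) :=
    fun l => hN ι p _ (isUpperSet_update_inter hU m l)
  refine ⟨?_, fun h => ?_, fun h => masterFamilyEqIff_mpr (k + 3) ι p U h⟩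
  · rw [sahiE_ind_step p U m hZ]; exact sum_nonneg fun l _ => hterm l
  · rw [sahiE_ind_step p U m hZ, sum_eq_zero_iff_of_nonneg fun l _ => hterm l] at h
    exact ⟨m, hZ, fun l => (hE ι p hp _ (isUpperSet_update_inter hU m l)).1 (h l (mem_univ l))⟩

/-- **Positivity on families with a zero-flag sub-family, closed cube**: given `MasterFamilyNonneg (k+2)`, if
`U_{−m} ∈ Z_{k+2}` then `E_{k+3}(μ_p; 1_U) ≥ 0` for every `p ∈ [0,1]^ι`. [this work] -/
theorem sahiE_ind_nonneg_of_subfamily {k : ℕ} (hN : MasterFamilyNonneg (k + 2)) {ι : Type} [Fintype ι]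
    (p : ι → unitInterval) (U : Fin (k + 3) → Set (Set ι)) (hU : ∀ j, IsUpperSet (U j)) (m : Fin (k + 3))
    (hZ : SuppZeroFlag (k + 2) (fun j => U (m.succAbove j))) :
    0 ≤ sahiE (bernoulliWeight p) (k + 3) (fun j => ind (U j)) := by
  rw [sahiE_ind_step p U m hZ]
  exact sum_nonneg fun l _ => hN ι p _ (isUpperSet_update_inter hU m l)

/-- **Kahn's Conjecture 5 on triples with an independent pair**: for three increasing events such that the two
events other than `U_m` are determined by disjoint coordinate sets, `E_3(μ_p; 1_{U_0}, 1_{U_1}, 1_{U_2}) ≥ 0` for every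
`p ∈ [0,1]^ι` (`E_3 = Cov(U_l ∩ U_m, U_{l'}) + Cov(U_l, U_{l'} ∩ U_m)`, two Harris terms). [this work] -/
theorem sahiE_three_ind_nonneg_of_indepPair {ι : Type} [Fintype ι] (p : ι → unitInterval)
    (U : Fin 3 → Set (Set ι)) (hU : ∀ j, IsUpperSet (U j)) (m : Fin 3)
    (hZ : SuppZeroFlag 2 (fun j => U (m.succAbove j))) :
    0 ≤ sahiE (bernoulliWeight p) 3 (fun j => ind (U j)) :=
  sahiE_ind_nonneg_of_subfamily (masterFamilyNonneg_of_le_two le_rfl) p U hU m hZ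

/-- **(EQ-3) on triples with an independent pair**: for `p` in the open cube and three increasing events such that
the two events other than `U_m` are determined by disjoint coordinate sets, `E_3(μ_p; 1_U) = 0 ↔ U ∈ Z_3` (criterion
(Z)), by Harris and strict Harris. [this work] -/
theorem sahiE_three_ind_eq_zero_iff_of_indepPair {ι : Type} [Fintype ι] (p : ι → unitInterval)
    (hp : ∀ e, (p e : ℝ) ∈ Set.Ioo (0 : ℝ) 1) (U : Fin 3 → Set (Set ι)) (hU : ∀ j, IsUpperSet (U j)) (m : Fin 3)
    (hZ : SuppZeroFlag 2 (fun j => U (m.succAbove j))) :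
    sahiE (bernoulliWeight p) 3 (fun j => ind (U j)) = 0 ↔ SuppZeroFlag 3 U :=
  (masterFamily_step (masterFamilyNonneg_of_le_two le_rfl) masterFamilyEqIff_two p hp U hU m hZ).2

end Step

/-! ### Heredity of zeros -/

/-- **Heredity of zeros, order `k`** (OUR CONJECTURE for `k ≥ 3`, a statement, never a fact): for `p` in the open cube
and `k` increasing events, `E_k(μ_p; 1_U) = 0` forces `E_{k−1}(μ_p; 1_{U_{−m}}) = 0` for some deleted slot `m`
(orders `≤ 2`: vacuous / trivial).  Equivalent to `MasterFamilyEqIff k` given the master statements of order `k − 1`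
(`masterFamilyEqIff_iff_heredity`). [this work] [status: open for k ≥ 3] -/
@[conjecture] def MasterFamilyHeredity : ℕ → Prop
  | 0 => True
  | k + 1 => ∀ (ι : Type) [Fintype ι] (p : ι → unitInterval), (∀ e, (p e : ℝ) ∈ Set.Ioo (0 : ℝ) 1) →
      ∀ U : Fin (k + 1) → Set (Set ι), (∀ j, IsUpperSet (U j)) →
        sahiE (bernoulliWeight p) (k + 1) (fun j => ind (U j)) = 0 →
          ∃ m : Fin (k + 1), sahiE (bernoulliWeight p) k (fun j => ind (U (m.succAbove j))) = 0

/-- `MasterFamilyEqIff (k+3)` implies heredity of order `k + 3` (a zero flag has a zero sub-family). [this work] -/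
theorem masterFamilyHeredity_of_eqIff {k : ℕ} (hE : MasterFamilyEqIff (k + 3)) : MasterFamilyHeredity (k + 3) := by
  intro ι _ p hp U hU h0
  obtain ⟨m, hm, -⟩ := (hE ι p hp U hU).1 h0
  exact ⟨m, masterFamilyEqIff_mpr (k + 2) ι p _ hm⟩

/-- **Heredity ⟺ equality** at order `k + 3`, given the master statements of order `k + 2`. [this work] -/
theorem masterFamilyEqIff_iff_heredity {k : ℕ} (hN : MasterFamilyNonneg (k + 2)) (hE : MasterFamilyEqIff (k + 2)) :
    MasterFamilyEqIff (k + 3) ↔ MasterFamilyHeredity (k + 3) := by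
  refine ⟨masterFamilyHeredity_of_eqIff, fun hH ι _ p hp U hU => ⟨fun h0 => ?_, masterFamilyEqIff_mpr _ ι p U⟩⟩
  obtain ⟨m, hm⟩ := hH ι p hp U hU h0
  have hZ : SuppZeroFlag (k + 2) (fun j => U (m.succAbove j)) := (hE ι p hp _ fun j => hU _).1 hm
  exact (masterFamily_step hN hE p hp U hU m hZ).2.1 h0

/-- **Unconditionally: `MasterFamilyEqIff 3 ↔ MasterFamilyHeredity 3`** ("(Z) is the zero locus of `E_3`" iff
"`E_3 = 0` forces an independent pair"). [this work] -/
theorem masterFamilyEqIff_three_iff_heredity : MasterFamilyEqIff 3 ↔ MasterFamilyHeredity 3 :=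
  masterFamilyEqIff_iff_heredity (masterFamilyNonneg_of_le_two le_rfl) masterFamilyEqIff_two

/-! ### The identically-zero form -/

/-- **Master family, equality half, IDENTICALLY-ZERO form** (OUR CONJECTURE for `k ≥ 3`; a statement, never a fact):
for `k` increasing events on a finite `ι`, `E_k(μ_p; 1_U) = 0` for EVERY `p` in the open cube iff `U ∈ Z_k`.  `⇐`
holds for every `k` (`masterFamilyIdentEqIff_mpr`); implied by the pointwise form (`masterFamilyIdentEqIff_of_eqIff`),
hence a theorem for `k ≤ 2`; for `k = 3` equivalent to `SahiE3NonvanishingOfPairwiseDependent`.  This form does NOT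
contain `C_k`. [this work] [status: open for k ≥ 3] -/
@[conjecture] def MasterFamilyIdentEqIff (k : ℕ) : Prop :=
  ∀ (ι : Type) [Fintype ι] (U : Fin k → Set (Set ι)), (∀ j, IsUpperSet (U j)) →
    ((∀ p : ι → unitInterval, (∀ e, (p e : ℝ) ∈ Set.Ioo (0 : ℝ) 1) →
        sahiE (bernoulliWeight p) k (fun j => ind (U j)) = 0) ↔ SuppZeroFlag k U)

/-- The centre of the cube, an interior parameter vector (exists even for empty `ι`). [folklore] -/
def halfParams (ι : Type*) : ι → unitInterval := fun _ => ⟨1 / 2, by norm_num, by norm_num⟩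

/-- The centre is interior. [folklore] -/
theorem halfParams_mem_Ioo (ι : Type*) (e : ι) : (halfParams ι e : ℝ) ∈ Set.Ioo (0 : ℝ) 1 := by
  simp only [halfParams]; norm_num

/-- The proved direction of the identically-zero form, every `k`. [this work] -/
theorem masterFamilyIdentEqIff_mpr (k : ℕ) (ι : Type) [Fintype ι] (U : Fin k → Set (Set ι)) (hZ : SuppZeroFlag k U)
    (p : ι → unitInterval) : sahiE (bernoulliWeight p) k (fun j => ind (U j)) = 0 :=
  masterFamilyEqIff_mpr k ι p U hZ

/-- **Pointwise ⇒ identically-zero form.** [this work] -/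
theorem masterFamilyIdentEqIff_of_eqIff {k : ℕ} (h : MasterFamilyEqIff k) : MasterFamilyIdentEqIff k := by
  intro ι _ U hU
  exact ⟨fun hall => (h ι (halfParams ι) (halfParams_mem_Ioo ι) U hU).1 (hall _ (halfParams_mem_Ioo ι)),
    fun hZ p _ => masterFamilyIdentEqIff_mpr k ι U hZ p⟩

/-- The identically-zero form holds for `k ≤ 2`. [this work] -/
theorem masterFamilyIdentEqIff_of_le_two {k : ℕ} (hk : k ≤ 2) : MasterFamilyIdentEqIff k :=
  masterFamilyIdentEqIff_of_eqIff (masterFamilyEqIff_of_le_two hk)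

/-! ### `k = 3`: reduction to pairwise-dependent triples -/

/-- **Pairwise dependence** of three events: no two of them are determined by disjoint coordinate sets (for increasing
events in the open cube: every two are strictly positively correlated). [this work] -/
def PairwiseDependent {ι : Type*} (U : Fin 3 → Set (Set ι)) : Prop :=
  ∀ m : Fin 3, ¬ SuppZeroFlag 2 (fun j => U (m.succAbove j))

/-- **(T) Non-vanishing on pairwise-dependent triples** (OUR CONJECTURE; a statement, never a fact): three increasing
events on a finite `ι`, every two of which share an essential coordinate, have `E_3(μ_p; 1_U) ≠ 0` for SOME `p` in the
open cube (equivalently: the polynomial `p ↦ E_3(μ_p; 1_U)` is not identically zero).  Equivalent to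
`MasterFamilyIdentEqIff 3` (`masterFamilyIdentEqIff_three_iff`).  PROVED sub-case (paper, this unit): a coordinate
pivotal for all three events makes the `p_e³`-coefficient `I_e(U_0)I_e(U_1)I_e(U_2) > 0`.  Census-exact on `{0,1}^m`,
`m ≤ 5`. [this work] [status: open] -/
@[conjecture] def SahiE3NonvanishingOfPairwiseDependent : Prop :=
  ∀ (ι : Type) [Fintype ι] (U : Fin 3 → Set (Set ι)), (∀ j, IsUpperSet (U j)) → PairwiseDependent U →
    ∃ p : ι → unitInterval, (∀ e, (p e : ℝ) ∈ Set.Ioo (0 : ℝ) 1) ∧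
      sahiE (bernoulliWeight p) 3 (fun j => ind (U j)) ≠ 0

/-- A zero flag of order `3` has an independent pair. [this work] -/
theorem not_pairwiseDependent_of_suppZeroFlag {ι : Type*} {U : Fin 3 → Set (Set ι)} (hZ : SuppZeroFlag 3 U) :
    ¬ PairwiseDependent U := by
  obtain ⟨m, hm, -⟩ := hZ
  exact fun h => h m hm

/-- **`MasterFamilyIdentEqIff 3 ↔ (T)`**: the identically-zero form of (EQ-3) is exactly non-vanishing on
pairwise-dependent triples — triples with an independent pair are settled by
`sahiE_three_ind_eq_zero_iff_of_indepPair`. [this work] -/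
theorem masterFamilyIdentEqIff_three_iff : MasterFamilyIdentEqIff 3 ↔ SahiE3NonvanishingOfPairwiseDependent := by
  constructor
  · intro hI ι _ U hU hPD
    by_contra hall
    push Not at hall
    exact not_pairwiseDependent_of_suppZeroFlag ((hI ι U hU).1 fun p hp => hall p hp) hPD
  · intro hT ι _ U hU
    refine ⟨fun hall => ?_, fun hZ p _ => masterFamilyIdentEqIff_mpr 3 ι U hZ p⟩
    by_cases hPD : PairwiseDependent U
    · obtain ⟨p, hp, hne⟩ := hT ι U hU hPD
      exact absurd (hall p hp) hne
    · simp only [PairwiseDependent, not_forall, not_not] at hPD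
      obtain ⟨m, hm⟩ := hPD
      exact (sahiE_three_ind_eq_zero_iff_of_indepPair (halfParams ι) (halfParams_mem_Ioo ι) U hU m hm).1
        (hall _ (halfParams_mem_Ioo ι))

end Summit.CriticalPhenomena.PercolationContinuityZ3.Theorems
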